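import Summits.BirchSwinnertonDyer.BirchSwinnertonDyer.Theorems.AlignedTransportAtTwoMainConjectureOfRankZeroBSDAtTwoHalfDescentLayerIndexGrowthDual
import HarnessLib

/-!
# Route `AlignedTransportAtTwo`, crux C2 `MainConjectureOfRankZeroBSDAtTwo` (stmt-BirchSwinnertonDyer-22298):
# THE GROWTH NUMBER WITHOUT GREENBERG 4.14, VII — `p = 2`: THE SIGNED OBJECTS. With `σ = conj_γ^{2ⁿ}` (an involution on `Sel_∞^{Γ_{n+1}}`): the DESCENT number is the
# MINUS EIGENSPACE `M = {s ∈ Sel_{2^∞}(E/K_∞) : σs = −s}` (`= ker N_n`), the GROWTH number is the image `I = (σ − 1)·Sel_∞^{Γ_{n+1}}`, and `2M ⊆ I ⊆ M`: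
# `#I ∣ #M ∣ #I · #M[2]`, `M[2] = Sel_∞^{Γ_n}[2]` — at `2` the two one-layer currencies differ by at most the `2`-torsion of the layer-`n` invariants (every datum, every `n`)

HONEST FRAMING (cell `bsd-f1-sign2`, WIDTH-5 attached prover seat `bsd-line-att-p5` gen 56 on line `birth` of the lead `bsd-line-att-p2`;
`--supports` stmt-BirchSwinnertonDyer-22298, closes nothing; BSD is NOT proved by any of this; the crux C2, its verdict «blocked-on
`Rank1Residual.GreenbergMuConjectureIrreducible`» and every registered stub (P / T / Kμ / LimDoor / MuIneqʳ / PFμ⁺) are untouched). THEOREMS ONLY — no `def`,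
no instance, no named fact, no `sorry`. Route-independent (any number field `K`, any `ℤ₂`-extension, any Pontryagin-dual datum). Sequel of this gen's
`…HalfDescentLayerIndexGrowthDual` (`g_n = #((conj_γ^{pⁿ} − 1)·Sel_∞^{conj_γ^{p^{n+1}} = 1})`, any `p`, any rank) and of g54's Pontryagin pair
`#(X/Ψ_nX) = #ker(∑_{i<p}(conj_γ^{pⁿ})^i)`; the `p = 2` specialisation answers the cell's question «what is the signed object at 2» for the two one-layer
currencies of the lineage: both are cut out by the involution `σ = conj_γ^{2ⁿ}` of the relative quadratic layer `K_{n+1}/K_n`.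

THE POINT (`p = 2`, `S = Sel_{2^∞}(E/K_∞)`, `φ = conj_γ`, `σ = φ^{2ⁿ}`, so `φ^{2^{n+1}} − 1 = σ² − 1 = (σ+1)(σ−1)` and `N_n = 1 + σ`):
* §1 (pure group theory of an involution-like endomorphism) `map_sub_one_le_endInvariants_add_one`: **`I := (σ − 1)·ker(σ² − 1) ≤ M := ker(σ + 1)`**;
  `two_nsmul_mem_map_sub_one`: **`s ∈ M ⟹ 2s = (σ − 1)(−s) ∈ I`** (and `M ≤ ker(σ² − 1)` automatically); hence ★★ `natCard_map_dvd_natCard_endInvariants` **`#I ∣ #M`** and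
  ★★ `natCard_endInvariants_dvd_mul` **`#M ∣ #I · #M[2]`**, where `endInvariants_add_one_inf_two_eq`: **`M[2] = ker(σ − 1)[2]`** (on `2`-torsion `−s = s`): the
  `2`-torsion of the layer-`n` invariants.
* §2 (Selmer, `p = 2`) ★★ `natCard_layerQuotient_two_eq_natCard_endInvariants_add_one`: **`#(X/Ψ_nX) = #M`** (g54's pair at `p = 2`: `∑_{i<2} σ^i = 1 + σ`);
  with file VI (`g_n = #I`): ★★★ `natCard_layerQuotient_two_dvd_growth_mul` **`g_n ∣ #(X/Ψ_nX) ∣ g_n · #Sel_∞^{σ = 1}[2]`** for EVERY dual datum over a `ℤ₂`-extension and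
  EVERY `n` — no torsion, rank or finite-submodule hypothesis: at `2` the descent number (gens 54–55) exceeds the growth number (this gen) by AT MOST the order of
  the `2`-torsion of `Sel_∞^{Γ_n}`; file V says the excess is EXACTLY `#(F/2F)` eventually in a rank-`0` tower.
Reading for C2: for a seed (no rational `2`-torsion, `S₃`-image) the `2`-torsion `Sel_{2^∞}(W/ℚ_∞)^{Γ_n}[2]` is controlled by the `2`-Selmer group over `ℚ_n`;
the certificate currencies «`#ker N_n < 2^{2ⁿ}`» (g55) and «growth `< 2^{2ⁿ}`» (this gen) therefore agree up to a factor dividing `#Sel_∞^{Γ_n}[2]`. What is NOT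
claimed: nothing about any curve. Memo `Cruxes/MainConjectureOfRankZeroBSDAtTwo/LAYER-GROWTH-att-p5-g56.md`.

References: R. Greenberg, LNM 1716 (1999), §1 pp. 60–65, §3 p. 85 [GreenbergLNM1716]; B. Mazur, Invent. Math. 18 (1972) §6 [Mazur1972]; L. Washington, GTM 83,
§13.3–13.4 [Washington1997].
-/

set_option linter.dupNamespace false
set_option autoImplicit false

noncomputable section

open scoped Classical AddSubgroup Polynomial

universe u

namespace Summit.BirchSwinnertonDyer.BirchSwinnertonDyer.Theorems.AlignedTransportAtTwoHalfDescentLayerIndexGrowthTwo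

open WeierstrassCurve Literature.NumberTheory.EllipticCurves Literature.NumberTheory.EllipticCurves.IwasawaDual
  Literature.NumberTheory.EllipticCurves.PontryaginCard
  Literature.NumberTheory.EllipticCurves.IwasawaAlgebra
  Summit.BirchSwinnertonDyer.Rank1Residual.X1.MuLambda
  Summit.BirchSwinnertonDyer.Rank1Residual.Iwasawa
  Summit.BirchSwinnertonDyer.BirchSwinnertonDyer.Theorems.DefectPrime
  Summit.BirchSwinnertonDyer.BirchSwinnertonDyer.Theorems.AlignedTransportAtTwoCyclotomicLayerPrime
  Summit.BirchSwinnertonDyer.BirchSwinnertonDyer.Theorems.AlignedTransportAtTwoHalfDescentLayerIndexSelmer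
  Summit.BirchSwinnertonDyer.BirchSwinnertonDyer.Theorems.AlignedTransportAtTwoHalfDescentLayerIndexGrowth
  Summit.BirchSwinnertonDyer.BirchSwinnertonDyer.Theorems.AlignedTransportAtTwoHalfDescentLayerIndexGrowthDual

/-! ## §1 An endomorphism `σ` with `σ² − 1` killing `K`: `2·ker(σ+1) ⊆ (σ−1)K ⊆ ker(σ+1)` -/

section Involution

variable {S : Type*} [AddCommGroup S] (σ : AddMonoid.End S)

/-- `(σ + 1)(σ − 1) = σ·σ − 1` applied: **`(σ − 1)·ker(σ·σ − 1) ≤ ker(σ + 1)`**. [folklore] -/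
theorem map_sub_one_le_endInvariants_add_one :
    (endInvariants (σ * σ - 1)).map (AddMonoidHomClass.toAddMonoidHom (σ - 1)) ≤ endInvariants (σ + 1) := by
  intro s hs
  obtain ⟨k, hk, rfl⟩ := AddSubgroup.mem_map.mp hs
  rw [mem_endInvariants_iff] at hk ⊢
  change ((σ + 1) * (σ - 1)) k = 0
  rw [← mul_self_sub_one]
  exact hk

/-- `s ∈ ker(σ + 1)` means `σ s = −s`. [folklore] -/
theorem apply_eq_neg_of_mem_endInvariants_add_one {s : S} (hs : s ∈ endInvariants (σ + 1)) : σ s = -s := by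
  rw [mem_endInvariants_iff] at hs
  have h : σ s + s = 0 := hs
  exact eq_neg_of_add_eq_zero_left h

/-- **`s ∈ ker(σ + 1) ⟹ 2s = (σ − 1)(−s) ∈ (σ − 1)·ker(σ·σ − 1)`** (`σs = −s` gives `σσs = s`). [folklore] -/
theorem two_nsmul_mem_map_sub_one {s : S} (hs : s ∈ endInvariants (σ + 1)) :
    (2 : ℕ) • s ∈ (endInvariants (σ * σ - 1)).map (AddMonoidHomClass.toAddMonoidHom (σ - 1)) := by
  have hσ := apply_eq_neg_of_mem_endInvariants_add_one σ hs
  refine AddSubgroup.mem_map.mpr ⟨-s, ?_, ?_⟩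
  · rw [mem_endInvariants_iff]
    change σ (σ (-s)) - (1 : AddMonoid.End S) (-s) = 0
    rw [AddMonoid.End.one_apply, map_neg, hσ, neg_neg, hσ, sub_self]
  · change σ (-s) - (1 : AddMonoid.End S) (-s) = (2 : ℕ) • s
    rw [AddMonoid.End.one_apply, map_neg, hσ, neg_neg, sub_neg_eq_add, two_nsmul]

/-- `ker(σ + 1) ≤ ker(σ·σ − 1)`. [folklore] -/
theorem endInvariants_add_one_le : endInvariants (σ + 1) ≤ endInvariants (σ * σ - 1) := by
  intro s hs
  have hσ := apply_eq_neg_of_mem_endInvariants_add_one σ hs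
  rw [mem_endInvariants_iff]
  change σ (σ s) - (1 : AddMonoid.End S) s = 0
  rw [AddMonoid.End.one_apply, hσ, map_neg, hσ, neg_neg, sub_self]

/-- ★★ **`#((σ − 1)·ker(σ·σ − 1)) ∣ #ker(σ + 1)`** (`Nat.card`). [folklore] -/
theorem natCard_map_dvd_natCard_endInvariants :
    Nat.card ↥((endInvariants (σ * σ - 1)).map (AddMonoidHomClass.toAddMonoidHom (σ - 1))) ∣ Nat.card ↥(endInvariants (σ + 1)) :=
  AddSubgroup.card_dvd_of_le (map_sub_one_le_endInvariants_add_one σ)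

/-- On `2`-torsion `−s = s`: **`ker(σ + 1) ∩ S[2] = ker(σ − 1) ∩ S[2]`** (`S[2] = ker 2`). [folklore] -/
theorem endInvariants_add_one_inf_two_eq :
    endInvariants (σ + 1) ⊓ endInvariants (2 : AddMonoid.End S) = endInvariants (σ - 1) ⊓ endInvariants (2 : AddMonoid.End S) := by
  ext s
  simp only [AddSubgroup.mem_inf, mem_endInvariants_iff, AddMonoid.End.ofNat_apply]
  constructor
  · rintro ⟨h1, h2⟩
    have h1' : σ s + s = 0 := h1
    have hs : -s = s := by rw [neg_eq_iff_add_eq_zero, ← two_nsmul, h2]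
    refine ⟨?_, h2⟩
    change σ s - (1 : AddMonoid.End S) s = 0
    rw [AddMonoid.End.one_apply, eq_neg_of_add_eq_zero_left h1', hs, sub_self]
  · rintro ⟨h1, h2⟩
    have h1' : σ s - s = 0 := h1
    refine ⟨?_, h2⟩
    change σ s + (1 : AddMonoid.End S) s = 0
    rw [AddMonoid.End.one_apply, sub_eq_zero.mp h1', ← two_nsmul, h2]

/-- ★★ **`#ker(σ + 1) ∣ #((σ − 1)·ker(σ·σ − 1)) · #(ker(σ + 1) ∩ S[2])`**: multiplication by `2` maps `M = ker(σ+1)` into `I = (σ−1)·ker(σσ−1)` with kernel `M[2]`,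
so `#M = #(2M)·#M[2]` and `#(2M) ∣ #I`. [folklore] -/
theorem natCard_endInvariants_dvd_mul :
    Nat.card ↥(endInvariants (σ + 1)) ∣
      Nat.card ↥((endInvariants (σ * σ - 1)).map (AddMonoidHomClass.toAddMonoidHom (σ - 1))) *
        Nat.card ↥(endInvariants (σ + 1) ⊓ endInvariants (2 : AddMonoid.End S)) := by
  set M : AddSubgroup S := endInvariants (σ + 1) with hM
  set I : AddSubgroup S := (endInvariants (σ * σ - 1)).map (AddMonoidHomClass.toAddMonoidHom (σ - 1)) with hI
  -- `d = 2·` on `M`, landing in `S`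
  set d : ↥M →+ S := (AddMonoidHomClass.toAddMonoidHom (2 : AddMonoid.End S)).comp M.subtype with hd
  have hd_apply : ∀ s : M, d s = (2 : ℕ) • (s : S) := fun s ↦ by
    change (2 : AddMonoid.End S) (s : S) = _
    exact AddMonoid.End.ofNat_apply 2 (s : S)
  have hrange : d.range ≤ I := by
    rintro _ ⟨s, rfl⟩
    rw [hd_apply]
    exact two_nsmul_mem_map_sub_one σ s.2
  have hker : Nat.card d.ker = Nat.card ↥(M ⊓ endInvariants (2 : AddMonoid.End S)) := by
    refine Nat.card_congr ⟨fun s ↦ ⟨(s.1 : S), AddSubgroup.mem_inf.mpr ⟨s.1.2, ?_⟩⟩, fun s ↦ ⟨⟨s.1, (AddSubgroup.mem_inf.mp s.2).1⟩, ?_⟩,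
      fun _ ↦ rfl, fun _ ↦ rfl⟩
    · have h := s.2
      rw [AddMonoidHom.mem_ker, hd_apply] at h
      rw [mem_endInvariants_iff, AddMonoid.End.ofNat_apply]
      exact h
    · have h := (mem_endInvariants_iff _ _).mp (AddSubgroup.mem_inf.mp s.2).2
      rw [AddMonoid.End.ofNat_apply] at h
      rw [AddMonoidHom.mem_ker, hd_apply]
      exact h
  have hsplit : Nat.card ↥M = Nat.card d.range * Nat.card d.ker := by
    rw [AddSubgroup.card_eq_card_quotient_mul_card_addSubgroup d.ker, Nat.card_congr (QuotientAddGroup.quotientKerEquivRange d).toEquiv]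
  rw [hsplit, hker]
  exact mul_dvd_mul_right (AddSubgroup.card_dvd_of_le hrange) _

end Involution

/-! ## §2 `p = 2`: descent number `= #ker(σ + 1)`, growth number `= #((σ − 1)·ker(σ² − 1))`, `σ = conj_γ^{2ⁿ}` -/

section Selmer

variable {K : Type u} [Field K] [NumberField K] (W : WeierstrassCurve K) (κ : ZpExtension K 2) {γ : Field.absoluteGaloisGroup K}

/-- ★★ **`p = 2`: `#(X/Ψ_nX) = #{s ∈ Sel_{2^∞}(E/K_∞) : conj_γ^{2ⁿ} s = −s}`** — the descent number is the order of the MINUS eigenspace `ker(σ + 1)` of the involution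
`σ = conj_γ^{2ⁿ}` (g54's Pontryagin pair `#(X/Ψ_nX) = #ker N_n` with `N_n = ∑_{i<2} σ^i = 1 + σ`). [cite: GreenbergLNM1716, §1 pp. 60, 65] -/
theorem natCard_layerQuotient_two_eq_natCard_endInvariants_add_one (hγ : κ.IsTopGenerator γ) (D : W.SelmerDualData κ γ) (n : ℕ) :
    Nat.card (D.X ⧸ (Ideal.span {(((Polynomial.cyclotomic (2 ^ (n + 1)) ℤ_[2]).comp (Polynomial.X + 1) : ℤ_[2][X]) : IwasawaAlgebra 2)} • ⊤ :
        Submodule (IwasawaAlgebra 2) D.X)) = Nat.card ↥(endInvariants ((W.conjSelmerInfty κ γ) ^ (2 ^ n) + 1)) := by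
  rw [natCard_layerQuotient_cyclotomic_eq_natCard_endInvariants W κ hγ D n]
  congr 2
  rw [Finset.sum_range_succ, Finset.sum_range_one, pow_zero, pow_one, add_comm]

/-- `p = 2`: `conj_γ^{2^{n+1}} − 1 = σ·σ − 1`, `σ = conj_γ^{2ⁿ}`. [folklore] -/
theorem conj_pow_succ_sub_one_eq (n : ℕ) :
    (W.conjSelmerInfty κ γ) ^ (2 ^ (n + 1)) - 1 = (W.conjSelmerInfty κ γ) ^ (2 ^ n) * (W.conjSelmerInfty κ γ) ^ (2 ^ n) - 1 := by
  rw [← pow_add, ← two_mul, ← pow_succ']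

/-- ★★ **`p = 2`: the growth number is `#((σ − 1)·Sel_∞^{σ² = 1})`**, `σ = conj_γ^{2ⁿ}` (file VI at `p = 2`). [cite: GreenbergLNM1716, §1 pp. 60–65] -/
theorem natCard_growth_two_eq_natCard_map (hγ : κ.IsTopGenerator γ) (D : W.SelmerDualData κ γ) (n : ℕ) :
    Nat.card (↥(Ideal.span {((1 + PowerSeries.X : PowerSeries ℤ_[2]) ^ (2 ^ n) - 1 : IwasawaAlgebra 2)} • ⊤ : Submodule (IwasawaAlgebra 2) D.X) ⧸
        (Ideal.span {(((Polynomial.cyclotomic (2 ^ (n + 1)) ℤ_[2]).comp (Polynomial.X + 1) : ℤ_[2][X]) : IwasawaAlgebra 2)} • ⊤ :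
          Submodule (IwasawaAlgebra 2) ↥(Ideal.span {((1 + PowerSeries.X : PowerSeries ℤ_[2]) ^ (2 ^ n) - 1 : IwasawaAlgebra 2)} • ⊤ :
            Submodule (IwasawaAlgebra 2) D.X))) =
      Nat.card ↥((endInvariants ((W.conjSelmerInfty κ γ) ^ (2 ^ n) * (W.conjSelmerInfty κ γ) ^ (2 ^ n) - 1)).map
        (AddMonoidHomClass.toAddMonoidHom ((W.conjSelmerInfty κ γ) ^ (2 ^ n) - 1))) := by
  rw [natCard_growth_eq_natCard_map W κ hγ D n, conj_pow_succ_sub_one_eq W κ n]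

/-- ★★★ **`p = 2`: `g_n ∣ #(X/Ψ_nX) ∣ g_n · #(Sel_∞^{σ = 1} ∩ Sel_∞[2])`** for EVERY Pontryagin-dual datum over a `ℤ₂`-extension and EVERY `n` (`σ = conj_γ^{2ⁿ}`;
`Sel_∞^{σ = 1} = Sel_∞^{Γ_n}`): the descent number of gens 54–55 (minus eigenspace of `σ`) and this gen's growth number (image of `σ − 1` on the `Γ_{n+1}`-invariants)
differ by a factor DIVIDING the order of the `2`-torsion of the layer-`n` invariants — no torsion, rank or finite-submodule hypothesis.
[cite: GreenbergLNM1716, §1 pp. 60–65 and §3 p. 85] [cite: Mazur1972, §6] -/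
theorem natCard_layerQuotient_two_dvd_growth_mul (hγ : κ.IsTopGenerator γ) (D : W.SelmerDualData κ γ) (n : ℕ) :
    Nat.card (↥(Ideal.span {((1 + PowerSeries.X : PowerSeries ℤ_[2]) ^ (2 ^ n) - 1 : IwasawaAlgebra 2)} • ⊤ : Submodule (IwasawaAlgebra 2) D.X) ⧸
        (Ideal.span {(((Polynomial.cyclotomic (2 ^ (n + 1)) ℤ_[2]).comp (Polynomial.X + 1) : ℤ_[2][X]) : IwasawaAlgebra 2)} • ⊤ :
          Submodule (IwasawaAlgebra 2) ↥(Ideal.span {((1 + PowerSeries.X : PowerSeries ℤ_[2]) ^ (2 ^ n) - 1 : IwasawaAlgebra 2)} • ⊤ :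
            Submodule (IwasawaAlgebra 2) D.X))) ∣
      Nat.card (D.X ⧸ (Ideal.span {(((Polynomial.cyclotomic (2 ^ (n + 1)) ℤ_[2]).comp (Polynomial.X + 1) : ℤ_[2][X]) : IwasawaAlgebra 2)} • ⊤ :
        Submodule (IwasawaAlgebra 2) D.X)) ∧
    Nat.card (D.X ⧸ (Ideal.span {(((Polynomial.cyclotomic (2 ^ (n + 1)) ℤ_[2]).comp (Polynomial.X + 1) : ℤ_[2][X]) : IwasawaAlgebra 2)} • ⊤ :
        Submodule (IwasawaAlgebra 2) D.X)) ∣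
      Nat.card (↥(Ideal.span {((1 + PowerSeries.X : PowerSeries ℤ_[2]) ^ (2 ^ n) - 1 : IwasawaAlgebra 2)} • ⊤ : Submodule (IwasawaAlgebra 2) D.X) ⧸
        (Ideal.span {(((Polynomial.cyclotomic (2 ^ (n + 1)) ℤ_[2]).comp (Polynomial.X + 1) : ℤ_[2][X]) : IwasawaAlgebra 2)} • ⊤ :
          Submodule (IwasawaAlgebra 2) ↥(Ideal.span {((1 + PowerSeries.X : PowerSeries ℤ_[2]) ^ (2 ^ n) - 1 : IwasawaAlgebra 2)} • ⊤ :
            Submodule (IwasawaAlgebra 2) D.X))) *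
        Nat.card ↥(endInvariants ((W.conjSelmerInfty κ γ) ^ (2 ^ n) - 1) ⊓ endInvariants (2 : AddMonoid.End ↥(W.selmerInfty κ))) := by
  rw [natCard_layerQuotient_two_eq_natCard_endInvariants_add_one W κ hγ D n, natCard_growth_two_eq_natCard_map W κ hγ D n,
    ← endInvariants_add_one_inf_two_eq]
  exact ⟨natCard_map_dvd_natCard_endInvariants _, natCard_endInvariants_dvd_mul _⟩

end Selmer

end Summit.BirchSwinnertonDyer.BirchSwinnertonDyer.Theorems.AlignedTransportAtTwoHalfDescentLayerIndexGrowthTwo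

end
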